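/-
Copyright (c) 2026 the pub-hodgecm-mathlib formalisation cell (harness21).  Prover seat hodgecm-mathlib-R90-C10-p04 (g2), SLAB R90-TF, section S1 «Ch. 10∕12 local»,
cell «U4-RAM :182 B_pos» (line (D-1) of R90-C10-p05 (g2), L4 dealer K2E3-plan (g5)): brick (B-4), PART 3 «THE SKEW-LINE FIBRES AT POSITIVE DEPTH» for the U4Keys socket
:182 (ramified `χ₁` of positive depth, Branch B) = S1 A2′, crux H413 = `stmt-HodgeConjecture-24833`.  KERNEL module: THEOREMS ONLY (no definition, no named fact, no
`sorry`, no instance, no notation).  2026-09-05.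
-/
import Summits.HodgeConjecture.HodgeConjecture.Theorems.R90S1BposSkewLineCharacterIntegralDepth   -- ★ (B-4) PART 2 p863275 (this seat): (iii) `setIntegral_skewUnitBall_dite_one_add_eq_zero_of_posDepth`; brings ★ PART 1 `R90S1BposSkewBallCharacterTools` (§1 orthogonality on an invariant set, §2 product Fubini, §3 fibre constancy, §0 topology) and ★ (II)-b2∕b3a∕b1
import HarnessLib

/-!
# R90 · S1 ∕ U4Keys leaf (U4f-χ₁-ram-one-pos), BRANCH B — brick (B-4), PART 3: THE SKEW-LINE FIBRES `K(a)` AT POSITIVE DEPTH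
# `K(a) := ∫_{y ∈ R⁻, |a + y|_w = 1} χ₁((a + y)^) dμ⁻(y)` for a `σ`-FIXED `a`: `= 0` at `|a|_w = 1` (positive depth); `= ε₀·μ⁻{|y| = 1}` below the conductor; level invariance
# [Keys1984 §4–§5, §7 Thm (2); WeilBNT1967 Ch. II §5; Roche1998 §3–§4; Rogawski1990 §1.10, §12.2 (2)]

Cell `pub/hodgecm-mathlib` (D-0151), SLAB R90-TF, section S1 «Ch. 10∕12 local», crux H413 = `stmt-HodgeConjecture-24833` (lane `--supports … --as helper`), route of record
`HCCMUnconditional` (no route verbs); prover seat `hodgecm-mathlib-R90-C10-p04` (g2), hand (B-4) of the B_pos line (D-1) led by R90-C10-p05 (g2) — THIS PART = the line lead's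
STATEMENT LIST (F·) (R90 bus 2026-09-04T23:29:33Z «what (B-5)∕(B-5′) consume is the SKEW-LINE FIBRES `K(a)` … ★ p862267's three fibre lemmas RE-DONE AT POSITIVE DEPTH»).
THEOREMS ONLY (no `def`, no `instance`, no notation, no named-fact hypothesis, no `sorry`); ★-only imports (no `Lines` import).  NOT THE PAYER of :182.

FRAME (= ★ (II)-b2∕(II)-b3a v1 spellings; PART 1 ★ `R90S1BposSkewBallCharacterTools`, PART 2 ★ `R90S1BposSkewLineCharacterIntegralDepth`): `R := LocalRing L v` at a NON-SPLIT
place `v` (`w hw`), `v ∤ 2` (`h2w`), `σ := conjLocal L c v`, `R⁻ = HeisRing.skewPart σ`, `E r := χ₁(r̂)` if `r` is a unit else `0` (inline `dite`), `μ⁻ = μY` a regular additive Haar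
measure on `R⁻`; `K(a) := ∫ y in {y | |(a + y)_w| = 1}, E(a + y) ∂μY` for a `σ`-FIXED `a : R` (the `y`-fibre of the shell integrand in the Heisenberg chart `z = a + y`, ★ (II)-b3a);
`ε₀ := χ₁ δ₀` for a skew unit `δ₀`.  LETTERS: the Branch-B-inert letter `hfix` «`χ₁ = 1` on the `σ`-fixed units of absolute value one» (= ★ `apply_eq_one_of_branchB_of_fixed (hns hunr
χ₁ hB)` at an inert place); the LEVEL of `a` is `Valued.v (a w)` itself; «`χ₁` trivial at level `|a|`» is `htriv : ∀ u, |(u − 1)_w| ≤ |a|_w → χ₁ u = 1`, the depth WITNESS is a unit `u₀`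
with `|(u₀ − 1)_w| < |a|_w` (resp. `< 1`) and `χ₁ u₀ ≠ 1` (the line lead's `hcond` at `ϖ^{m+1}` and `u₁` at `ϖ^m` instantiate them shell by shell).

THE LIST (line lead 23:29:33Z; (F>) «`|a|_w > 1 ⇒ K(a) = 0`» is ★ `skewLineIntegral_eq_zero_of_one_lt_valued` as is):
* §1 (F∼) **`skewLineIntegral_eq_of_valued_eq`** — LEVEL INVARIANCE: `σ`-fixed `a, a′` with `|a|_w = |a′|_w ≠ 0` ⇒ `K(a′) = K(a)` (`t := â′â⁻¹` is a `σ`-fixed unit of absolute value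
  one: `a′ + ty = t(a + y)`, `E(t·) = χ₁(t̂)E(·) = E(·)` by `hfix`, and `y ↦ ty` ★ `smulSkew` preserves `μ⁻` and the region — the proof of ★ `skewLineIntegral_eq_of_valued_eq_one`).
* §2 (F<₁) **`skewLineIntegral_eq_of_valued_lt_one_of_trivial`** — BELOW THE CONDUCTOR: `|a|_w < 1` and `χ₁` trivial at level `|a|` ⇒ `K(a) = ε₀·μ⁻{|y|_w = 1}` (`a + y = ŷ(1 +
  ŷ⁻¹a)`, `|ŷ⁻¹a| = |a|`; `χ₁ ŷ = ε₀` for every skew unit `ŷ` since `ŷδ₀⁻¹` is fixed, `hfix`) — ★ `skewLineIntegral_eq_of_valued_lt_one` had `hdepth` (level `𝔪`) here.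
* §3 (F=) **`skewLineIntegral_eq_zero_of_valued_eq_one_of_posDepth`** — `|a|_w = 1` and `χ₁` of positive depth (witness `u₀ ∈ 1 + 𝔪`) ⇒ `K(a) = 0` (region `= {|y| ≤ 1}`, PART 1 §3 at
  radius `1`, then PART 2 (iii) `Φ₁ = 0`) — at depth ZERO the same fibre is `Φ₁ = −ε₀μ⁻(𝔪⁻) ≠ 0` (★ (II)-b2).
* (F<₂) «strictly between ⇒ `K(a) = 0`» and (F<₃) «AT the sharp level `K(a) = −ε₀·μ⁻{|y|_w < 1}`» are PART 4 `R90S1BposSkewLineFibresByOrthogonality` (the invariant-set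
  road of PART 2 on `{|(b + σb)_w| = |a|_w, |(b − σb)_w| = 1}` resp. `{|(b + σb)_w| ≤ |a|_w, |(b − σb)_w| = 1}`, closed by (F∼) and (F<₁) of this file).
HONEST LABEL.  HC_CM is proved only modulo the 7 printed citations (2 remaining named inputs: hLiu418 = `stmt-HodgeConjecture-24832`, h413 = `stmt-HodgeConjecture-24833`) until rung 0
closes; count-neutral — this file does NOT pay :182 (nor :155); no printed citation is discharged; REL ≠ ★ ≠ BUILT.

## References
* [Keys1984] D. Keys, *Principal series representations of special unitary groups over local fields*, Compositio Math. 51 (1984), §4–§5 (the rank-one integrals over `E × F` at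
  conductor `n`), §7 Theorem (2) p. 126.
* [WeilBNT1967] A. Weil, *Basic Number Theory* (1967), Ch. I §2–§4, Ch. II §5 (Haar measure under homotheties; orthogonality of a non-trivial character of a compact group).
* [Roche1998] A. Roche, *Types and Hecke algebras for principal series representations of split reductive p-adic groups*, Ann. Sci. ÉNS (4) 31 (1998), §3–§4.
* [Rogawski1990] J. D. Rogawski, *Automorphic Representations of Unitary Groups in Three Variables*, Ann. of Math. Stud. 123 (1990), §1.10 p. 9, §12.2 (2) p. 173.
-/

set_option autoImplicit false
-- the mandated namespace has the single-problem summit's repeated segment (`HodgeConjecture.HodgeConjecture`)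
set_option linter.dupNamespace false

noncomputable section

open NumberField IsDedekindDomain MeasureTheory Measure Topology Set
open scoped NNReal ENNReal
open Literature.NumberTheory Literature.NumberTheory.Automorphic Literature.NumberTheory.Automorphic.UnitaryGroup

namespace Summit.HodgeConjecture.HodgeConjecture.R90.S1.BposSkewLineFibresDepth

open Summit.HodgeConjecture.HodgeConjecture.Cruxes.H413
open Summit.HodgeConjecture.HodgeConjecture.Cruxes.H413.K2E3BranchBSkewUnitSign
open Summit.HodgeConjecture.HodgeConjecture.Cruxes.H413.K2E3BranchBSkewLineIntegrals
open Summit.HodgeConjecture.HodgeConjecture.Cruxes.H413.K2E3BranchBSkewLineCharacterIntegral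
open Summit.HodgeConjecture.HodgeConjecture.R90.S1.BposSkewBallCharacterTools
open Summit.HodgeConjecture.HodgeConjecture.R90.S1.BposSkewLineCharacterIntegralDepth

variable (L : Type) [Field L] [NumberField L] [IsCMField L] (v : HeightOneSpectrum (𝓞 ↥(maximalRealSubfield L)))
  (w : PlacesOver L v) (hw : IsCMField.complexConj L • w.1 = w.1)

/-! ## §0 Spheres of radius `|r|_w` and skew units -/

omit [IsCMField L] in
/-- The sphere `{z : |z| = |r|}` of `L_w` is OPEN when `r ≠ 0` (Mathlib `Valued.isOpen_sphere`, through `Valuation.restrict`). [cite: WeilBNT1967, Ch. I §2] -/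
theorem isOpen_setOf_valued_eq_valued {r : w.1.adicCompletion L} (hr : Valued.v r ≠ 0) :
    IsOpen {z : w.1.adicCompletion L | Valued.v z = Valued.v r} := by
  have h : {z : w.1.adicCompletion L | Valued.v z = Valued.v r} =
      {z : w.1.adicCompletion L | (Valued.v : Valuation (w.1.adicCompletion L) _).restrict z =
        (Valued.v : Valuation (w.1.adicCompletion L) _).restrict r} := by
    ext z
    rw [Set.mem_setOf_eq, Set.mem_setOf_eq, Valuation.restrict_inj]
  rw [h]
  exact Valued.isOpen_sphere _ (fun h0 => hr ((Valuation.restrict_eq_zero_iff _).1 h0))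

include hw in
/-- **`χ₁(δ) = χ₁(δ₀) =: ε₀` for every skew unit `δ` of absolute value one** from the letter `hfix` (`δδ₀⁻¹` is `σ`-fixed of absolute value one) — ★ `apply_skew_unit_eq` under
`(hunr, hB)`. [cite: Keys1984, §7] -/
theorem apply_skew_unit_eq_of_fixed (χ₁ : (LocalRing L v)ˣ →* ℂˣ)
    (hfix : ∀ u : (LocalRing L v)ˣ, (∀ w' : PlacesOver L v, Valued.v ((u : LocalRing L v) w') = 1) →
      conjLocal L (IsCMField.complexConj L) v (u : LocalRing L v) = u → χ₁ u = 1)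
    (δ₀ : (LocalRing L v)ˣ) (hδσ : conjLocal L (IsCMField.complexConj L) v (δ₀ : LocalRing L v) = -(δ₀ : LocalRing L v))
    (hδv : Valued.v ((δ₀ : LocalRing L v) w) = 1)
    (δ : (LocalRing L v)ˣ) (hδ : conjLocal L (IsCMField.complexConj L) v (δ : LocalRing L v) = -(δ : LocalRing L v))
    (hv : Valued.v ((δ : LocalRing L v) w) = 1) : χ₁ δ = χ₁ δ₀ := by
  have hfx : conjLocal L (IsCMField.complexConj L) v ((δ * δ₀⁻¹ : (LocalRing L v)ˣ) : LocalRing L v) = (δ * δ₀⁻¹ : (LocalRing L v)ˣ) := by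
    rw [Units.val_mul, map_mul, hδ, HeisRing.map_units_inv_of_antifixed (conjLocal L (IsCMField.complexConj L) v) δ₀ hδσ, neg_mul_neg]
  have hval : Valued.v (((δ * δ₀⁻¹ : (LocalRing L v)ˣ) : LocalRing L v) w) = 1 := by
    rw [Units.val_mul, Pi.mul_apply, map_mul, hv, valued_units_inv_apply_eq_one L v hδv, one_mul]
  have h := hfix _ (forall_placesOver_of_apply L v w hw hval) hfx
  rwa [map_mul, map_inv, mul_inv_eq_one] at h

/-! ## §1 (F∼) LEVEL INVARIANCE: `K(a′) = K(a)` when `|a′|_w = |a|_w ≠ 0` -/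

section Fibres

variable [MeasurableSpace (LocalRing L v)] [BorelSpace (LocalRing L v)]
  (μY : Measure ↥(HeisRing.skewPart (conjLocal L (IsCMField.complexConj L) v))) [μY.IsAddHaarMeasure] [μY.Regular]

open scoped Classical in
include hw in
/-- **(F∼) LEVEL INVARIANCE — `K(a′) = K(a)`** for `σ`-fixed `a, a′` with `|a′|_w = |a|_w ≠ 0`: `t := â′â⁻¹` is a `σ`-fixed unit with `|t|_w = 1`, `a′ + ty = t(a + y)`, so `|a′ + ty| = |a + y|`
and `E(a′ + ty) = χ₁(t̂)·E(a + y) = E(a + y)` (`hfix`; ★ `dite_chi_units_mul`), and `y ↦ ty` (★ `HeisRing.smulSkew`) preserves `μ⁻` (`χ⁻(t) = √‖t‖_R = 1`, ★ `map_smulSkew_eq`, ★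
`skewModulus_eq_sqrt`). [cite: Keys1984, §4, §7 Theorem (2) p. 126] [cite: WeilBNT1967, Ch. II §5] -/
theorem skewLineIntegral_eq_of_valued_eq (χ₁ : (LocalRing L v)ˣ →* ℂˣ)
    (hfix : ∀ u : (LocalRing L v)ˣ, (∀ w' : PlacesOver L v, Valued.v ((u : LocalRing L v) w') = 1) →
      conjLocal L (IsCMField.complexConj L) v (u : LocalRing L v) = u → χ₁ u = 1)
    {a a' : LocalRing L v} (ha : conjLocal L (IsCMField.complexConj L) v a = a) (ha' : conjLocal L (IsCMField.complexConj L) v a' = a')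
    (ha0 : Valued.v (a w) ≠ 0) (haa' : Valued.v (a' w) = Valued.v (a w)) :
    ∫ y in {y : ↥(HeisRing.skewPart (conjLocal L (IsCMField.complexConj L) v)) | Valued.v ((a' + (y : LocalRing L v)) w) = 1},
        (fun r : LocalRing L v => if h : IsUnit r then ((χ₁ h.unit : ℂˣ) : ℂ) else 0) (a' + (y : LocalRing L v)) ∂μY =
      ∫ y in {y : ↥(HeisRing.skewPart (conjLocal L (IsCMField.complexConj L) v)) | Valued.v ((a + (y : LocalRing L v)) w) = 1},
        (fun r : LocalRing L v => if h : IsUnit r then ((χ₁ h.unit : ℂˣ) : ℂ) else 0) (a + (y : LocalRing L v)) ∂μY := by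
  haveI : SecondCountableTopology (LocalRing L v) := secondCountableTopology_localRing (E := L) v
  have hσ := conjLocal_conjLocal_cm L v
  have hσc := continuous_conjLocal L (IsCMField.complexConj L) v
  -- the units `â`, `â′` and `t := â′ â⁻¹`
  have haU : IsUnit a := K2E3DepthZeroIwahoriCharacterCM.isUnit_of_apply_ne_zero L v w hw a (fun h => ha0 (by rw [h, map_zero]))
  have ha'0 : Valued.v (a' w) ≠ 0 := by rw [haa']; exact ha0
  have ha'U : IsUnit a' := K2E3DepthZeroIwahoriCharacterCM.isUnit_of_apply_ne_zero L v w hw a' (fun h => ha'0 (by rw [h, map_zero]))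
  set t : (LocalRing L v)ˣ := ha'U.unit * haU.unit⁻¹ with htdef
  have hta : (t : LocalRing L v) * a = a' := by
    rw [htdef, Units.val_mul, mul_assoc, haU.val_inv_mul, mul_one, ha'U.unit_spec]
  have hufix : conjLocal L (IsCMField.complexConj L) v (haU.unit : LocalRing L v) = haU.unit := by rw [haU.unit_spec]; exact ha
  have hu'fix : conjLocal L (IsCMField.complexConj L) v (ha'U.unit : LocalRing L v) = ha'U.unit := by rw [ha'U.unit_spec]; exact ha'
  have htfix : conjLocal L (IsCMField.complexConj L) v (t : LocalRing L v) = t := by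
    rw [htdef, Units.val_mul, map_mul, hu'fix, HeisRing.map_units_inv_of_fixed (conjLocal L (IsCMField.complexConj L) v) haU.unit hufix]
  have htv : Valued.v ((t : LocalRing L v) w) = 1 := by
    have h1 : Valued.v ((t : LocalRing L v) w) * Valued.v (a w) = Valued.v (a w) := by
      rw [← map_mul, ← Pi.mul_apply, hta, haa']
    exact (mul_eq_right₀ ha0).1 h1
  have hχt : χ₁ t = 1 := hfix t (forall_placesOver_of_apply L v w hw htv) htfix
  -- the substitution `y ↦ t y`
  set T := HeisRing.smulSkew (conjLocal L (IsCMField.complexConj L) v) t htfix with hT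
  obtain ⟨δ, hδ⟩ := exists_conjLocal_skew_unit L v
  have hmod : HeisRing.skewModulus (conjLocal L (IsCMField.complexConj L) v) hσc t htfix = 1 := by
    rw [HeisRing.skewModulus_eq_sqrt (conjLocal L (IsCMField.complexConj L) v) hσ hσc δ hδ t htfix,
      show distribHaarChar (LocalRing L v) t = unitModulusChar (LocalRing L v) t from rfl,
      unitModulusChar_eq_one_of_forall_v_eq_one L v t (forall_placesOver_of_apply L v w hw htv), NNReal.sqrt_one]
  have hpres : MeasurePreserving T μY μY := by
    refine ⟨T.continuous.measurable, ?_⟩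
    rw [hT, HeisRing.map_smulSkew_eq (conjLocal L (IsCMField.complexConj L) v) hσc t htfix μY, hmod, inv_one, one_smul]
  -- `a′ + t y = t (a + y)`
  have hlin : ∀ y : ↥(HeisRing.skewPart (conjLocal L (IsCMField.complexConj L) v)),
      a' + ((T y : ↥(HeisRing.skewPart (conjLocal L (IsCMField.complexConj L) v))) : LocalRing L v) = (t : LocalRing L v) * (a + (y : LocalRing L v)) := by
    intro y; rw [hT, HeisRing.coe_smulSkew, mul_add, hta]
  have hpre : T ⁻¹' {y : ↥(HeisRing.skewPart (conjLocal L (IsCMField.complexConj L) v)) | Valued.v ((a' + (y : LocalRing L v)) w) = 1} =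
      {y : ↥(HeisRing.skewPart (conjLocal L (IsCMField.complexConj L) v)) | Valued.v ((a + (y : LocalRing L v)) w) = 1} := by
    ext y
    rw [Set.mem_preimage, Set.mem_setOf_eq, Set.mem_setOf_eq, hlin, Pi.mul_apply, map_mul, htv, one_mul]
  have key := hpres.setIntegral_preimage_emb T.toHomeomorph.measurableEmbedding
    (fun y : ↥(HeisRing.skewPart (conjLocal L (IsCMField.complexConj L) v)) =>
      (fun r : LocalRing L v => if h : IsUnit r then ((χ₁ h.unit : ℂˣ) : ℂ) else 0) (a' + (y : LocalRing L v)))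
    {y : ↥(HeisRing.skewPart (conjLocal L (IsCMField.complexConj L) v)) | Valued.v ((a' + (y : LocalRing L v)) w) = 1}
  rw [hpre] at key
  rw [← key]
  refine setIntegral_congr_fun ?_ (fun y _ => ?_)
  · exact (measurableSet_setOf_valued_apply_eq_one L v w).preimage (continuous_const.add continuous_subtype_val).measurable
  · show (fun r : LocalRing L v => if h : IsUnit r then ((χ₁ h.unit : ℂˣ) : ℂ) else 0) (a' + ((T y : ↥(HeisRing.skewPart (conjLocal L (IsCMField.complexConj L) v))) : LocalRing L v)) = _
    rw [hlin, dite_chi_units_mul L v χ₁ t, hχt, Units.val_one, one_mul]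

/-! ## §2 (F<₁) BELOW THE CONDUCTOR: `K(a) = ε₀ · μ⁻{|y|_w = 1}` -/

open scoped Classical in
omit [μY.IsAddHaarMeasure] [μY.Regular] in
include hw in
/-- **(F<₁) — `|a|_w < 1` and `χ₁` trivial at level `|a|` ⇒ `K(a) = ε₀ · μ⁻{|y|_w = 1}`**: the region is the skew unit sphere `{|y|_w = 1}` (`|a + y| = max(|a|, |y|)`, ★
`valued_add_apply_eq_max`), and there `a + y = ŷ·(1 + ŷ⁻¹a)` with `|(ŷ⁻¹a)_w| = |a|_w`, so `E(a + y) = χ₁(ŷ)·χ₁((1 + ŷ⁻¹a)^) = ε₀ · 1` (§0 `apply_skew_unit_eq_of_fixed`; `htriv`).  ★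
`skewLineIntegral_eq_of_valued_lt_one` is the level-`𝔪` case (`hdepth`); here the level is `|a|` (any `a`, `a = 0` included). [cite: Keys1984, §4, §7 Theorem (2) p. 126] -/
theorem skewLineIntegral_eq_of_valued_lt_one_of_trivial (h2w : Valued.v (2 : w.1.adicCompletion L) = 1) (χ₁ : (LocalRing L v)ˣ →* ℂˣ)
    (hfix : ∀ u : (LocalRing L v)ˣ, (∀ w' : PlacesOver L v, Valued.v ((u : LocalRing L v) w') = 1) →
      conjLocal L (IsCMField.complexConj L) v (u : LocalRing L v) = u → χ₁ u = 1)
    (δ₀ : (LocalRing L v)ˣ) (hδσ : conjLocal L (IsCMField.complexConj L) v (δ₀ : LocalRing L v) = -(δ₀ : LocalRing L v)) (hδv : Valued.v ((δ₀ : LocalRing L v) w) = 1)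
    {a : LocalRing L v} (ha : conjLocal L (IsCMField.complexConj L) v a = a) (hav : Valued.v (a w) < 1)
    (htriv : ∀ u : (LocalRing L v)ˣ, Valued.v (((u : LocalRing L v) - 1) w) ≤ Valued.v (a w) → χ₁ u = 1) :
    ∫ y in {y : ↥(HeisRing.skewPart (conjLocal L (IsCMField.complexConj L) v)) | Valued.v ((a + (y : LocalRing L v)) w) = 1},
        (fun r : LocalRing L v => if h : IsUnit r then ((χ₁ h.unit : ℂˣ) : ℂ) else 0) (a + (y : LocalRing L v)) ∂μY =
      ((χ₁ δ₀ : ℂˣ) : ℂ) * (μY.real {y : ↥(HeisRing.skewPart (conjLocal L (IsCMField.complexConj L) v)) | Valued.v ((y : LocalRing L v) w) = 1} : ℂ) := by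
  letI : Invertible (2 : LocalRing L v) := (isUnit_two_localRing L v).invertible
  -- (i) the region is the unit sphere of `R⁻`
  have hreg : {y : ↥(HeisRing.skewPart (conjLocal L (IsCMField.complexConj L) v)) | Valued.v ((a + (y : LocalRing L v)) w) = 1} =
      {y : ↥(HeisRing.skewPart (conjLocal L (IsCMField.complexConj L) v)) | Valued.v ((y : LocalRing L v) w) = 1} := by
    ext y
    rw [Set.mem_setOf_eq, Set.mem_setOf_eq, valued_add_apply_eq_max L v w hw h2w ha ((HeisRing.mem_skewPart_iff _ _).1 y.2)]
    constructor
    · intro h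
      rcases le_total (Valued.v (a w)) (Valued.v ((y : LocalRing L v) w)) with hle | hle
      · rwa [max_eq_right hle] at h
      · rw [max_eq_left hle] at h; exact absurd h hav.ne
    · intro h; rw [h]; exact max_eq_right hav.le
  rw [hreg]
  have hmeasS := (measurableSet_skew_balls L v w).2.2
  -- (ii) on the sphere the integrand is the constant `ε₀`
  have hpt : ∀ y ∈ {y : ↥(HeisRing.skewPart (conjLocal L (IsCMField.complexConj L) v)) | Valued.v ((y : LocalRing L v) w) = 1},
      (fun r : LocalRing L v => if h : IsUnit r then ((χ₁ h.unit : ℂˣ) : ℂ) else 0) (a + (y : LocalRing L v)) = ((χ₁ δ₀ : ℂˣ) : ℂ) := by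
    intro y hy
    rw [Set.mem_setOf_eq] at hy
    have hUy : IsUnit (y : LocalRing L v) :=
      K2E3DepthZeroIwahoriCharacterCM.isUnit_of_apply_ne_zero L v w hw _ (fun h => by rw [h] at hy; exact zero_ne_one (by rw [← hy, map_zero]))
    set ŷ : (LocalRing L v)ˣ := hUy.unit with hŷdef
    have hŷy : (ŷ : LocalRing L v) = y := hUy.unit_spec
    have hŷv : Valued.v ((ŷ : LocalRing L v) w) = 1 := by rw [hŷy]; exact hy
    have hŷinvv : Valued.v (((ŷ⁻¹ : (LocalRing L v)ˣ) : LocalRing L v) w) = 1 := valued_units_inv_apply_eq_one L v hŷv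
    -- `1 + ŷ⁻¹ a` is a unit of level `|a|`
    have hv1 : Valued.v ((1 + ((ŷ⁻¹ : (LocalRing L v)ˣ) : LocalRing L v) * a) w) = 1 := by
      rw [Pi.add_apply, Pi.one_apply]
      exact Valuation.map_one_add_of_lt _ (by rw [Pi.mul_apply, map_mul, hŷinvv, one_mul]; exact hav)
    have hU1 : IsUnit (1 + ((ŷ⁻¹ : (LocalRing L v)ˣ) : LocalRing L v) * a) :=
      K2E3DepthZeroIwahoriCharacterCM.isUnit_of_apply_ne_zero L v w hw _ (fun h => by rw [h] at hv1; exact zero_ne_one (by rw [← hv1, map_zero]))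
    have hlev : Valued.v (((hU1.unit : LocalRing L v) - 1) w) ≤ Valued.v (a w) := by
      rw [IsUnit.unit_spec, add_sub_cancel_left, Pi.mul_apply, map_mul, hŷinvv, one_mul]
    have hUa : IsUnit (a + (y : LocalRing L v)) := by
      have : a + (y : LocalRing L v) = (ŷ : LocalRing L v) * (1 + ((ŷ⁻¹ : (LocalRing L v)ˣ) : LocalRing L v) * a) := by
        rw [mul_add, mul_one, ← mul_assoc, Units.mul_inv, one_mul, hŷy, add_comm]
      rw [this]; exact hUy.unit.isUnit.mul hU1
    simp only [dif_pos hUa]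
    have hunits : hUa.unit = ŷ * hU1.unit := by
      apply Units.ext
      rw [hUa.unit_spec, Units.val_mul, hU1.unit_spec, mul_add, mul_one, ← mul_assoc, Units.mul_inv, one_mul, hŷy, add_comm]
    have hŷskew : conjLocal L (IsCMField.complexConj L) v (ŷ : LocalRing L v) = -(ŷ : LocalRing L v) := by
      rw [hŷy]; exact (HeisRing.mem_skewPart_iff _ _).1 y.2
    rw [hunits, map_mul, htriv hU1.unit hlev, mul_one, apply_skew_unit_eq_of_fixed L v w hw χ₁ hfix δ₀ hδσ hδv ŷ hŷskew hŷv]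
  rw [setIntegral_congr_fun hmeasS hpt, setIntegral_const, Complex.real_smul, mul_comm]

/-! ## §3 (F=) AT ABSOLUTE VALUE ONE, POSITIVE DEPTH: `K(a) = 0` -/

open scoped Classical in
include hw in
/-- **(F=) — `|a|_w = 1` and `χ₁` of POSITIVE depth ⇒ `K(a) = 0`**: the region `{|a + y|_w = 1}` is the unit ball `{|y|_w ≤ 1}` (★ `valued_add_apply_eq_max`), the fibre over `a` equals
the fibre over `1` (PART 1 §3 `setIntegral_skewBall_dite_add_eq_of_fixed` at radius `|1| = 1`), and `Φ₁ = ∫_{|y| ≤ 1} E(1 + y) dμ⁻ = 0` at positive depth (PART 2 (iii)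
`setIntegral_skewUnitBall_dite_one_add_eq_zero_of_posDepth`, witness `u₀ ∈ 1 + 𝔪` with `χ₁ u₀ ≠ 1`).  At depth ZERO the same fibre is `−ε₀·μ⁻(𝔪⁻)` (★ (II)-b3a + ★ (II)-b2).
[cite: Keys1984, §4–§5, §7 Theorem (2) p. 126] [cite: WeilBNT1967, Ch. II §5] -/
theorem skewLineIntegral_eq_zero_of_valued_eq_one_of_posDepth (h2w : Valued.v (2 : w.1.adicCompletion L) = 1)
    (χ₁ : (LocalRing L v)ˣ →* ℂˣ) (h₁ : Continuous fun x => ((χ₁ x : ℂˣ) : ℂ))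
    (hfix : ∀ u : (LocalRing L v)ˣ, (∀ w' : PlacesOver L v, Valued.v ((u : LocalRing L v) w') = 1) →
      conjLocal L (IsCMField.complexConj L) v (u : LocalRing L v) = u → χ₁ u = 1)
    (u₀ : (LocalRing L v)ˣ) (hu₀ : Valued.v (((u₀ : LocalRing L v) - 1) w) < 1) (hχ : χ₁ u₀ ≠ 1)
    {a : LocalRing L v} (ha : conjLocal L (IsCMField.complexConj L) v a = a) (hav : Valued.v (a w) = 1) :
    ∫ y in {y : ↥(HeisRing.skewPart (conjLocal L (IsCMField.complexConj L) v)) | Valued.v ((a + (y : LocalRing L v)) w) = 1},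
        (fun r : LocalRing L v => if h : IsUnit r then ((χ₁ h.unit : ℂˣ) : ℂ) else 0) (a + (y : LocalRing L v)) ∂μY = 0 := by
  letI : Invertible (2 : LocalRing L v) := (isUnit_two_localRing L v).invertible
  have h1w : Valued.v ((1 : LocalRing L v) w) = 1 := by rw [Pi.one_apply, map_one]
  have hreg : {y : ↥(HeisRing.skewPart (conjLocal L (IsCMField.complexConj L) v)) | Valued.v ((a + (y : LocalRing L v)) w) = 1} =
      {y : ↥(HeisRing.skewPart (conjLocal L (IsCMField.complexConj L) v)) | Valued.v ((y : LocalRing L v) w) ≤ Valued.v ((1 : LocalRing L v) w)} := by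
    ext y
    rw [Set.mem_setOf_eq, Set.mem_setOf_eq, valued_add_apply_eq_max L v w hw h2w ha ((HeisRing.mem_skewPart_iff _ _).1 y.2), hav, h1w, max_eq_left_iff]
  rw [hreg, setIntegral_skewBall_dite_add_eq_of_fixed L v w hw μY h2w χ₁ hfix 1 h1w.le ha hav]
  have h := setIntegral_skewUnitBall_dite_one_add_eq_zero_of_posDepth L v w hw μY h2w χ₁ h₁ hfix u₀ hu₀ hχ
  rw [← h1w] at h
  exact h

end Fibres

end Summit.HodgeConjecture.HodgeConjecture.R90.S1.BposSkewLineFibresDepth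

end
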